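import Summits.RiemannHypothesis.RiemannHypothesis.Theorems.JensenPolynomialsPhiCellSeries

/-!
# Route `JensenPolynomials`, item `XiDeltaSqPos` (S-T5) — toolbox 4: the three cell checks and their soundness
(RH-FREE; cell rh-jensen, HUMAN RULING D-0040)

Fourth piece of the kernel certificate for the crux `XiDeltaSqPos` (Csordas–Varga 1988, Theorem 2.2). With
`F_m = ∑_n P_m(y_n)e^{−y_n}` (`phiSeries m`, `P₀, …, P₄` the polynomials of `Φ, Φ′, Φ″, Φ‴, Φ⁗`, so that
`Φ^{(m)}(u) = eᵘF_m(e^{4u})`), the monotonicity of `−Φ′(u)/(uΦ(u))` on `(0, 1/4]` reduces to the positivity of three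
forms on three ranges of `y₀ = πe^{4u}`:

* regime A (`u` near `0`, where `T = −Φ²Φ‴ + 3ΦΦ′Φ″ − 2Φ′³` vanishes at `0`): `T′e^{−3u} = −F₀²F₄ + F₀F₁F₃ + 3F₀F₂² − 3F₁²F₂ > 0`
  (`checkA`, `formA_pos_of_checkA`);
* regime T: `Te^{−3u} = −F₀²F₃ + 3F₀F₁F₂ − 2F₁³ > 0` (`checkT`, `formT_pos_of_checkT`), i.e. `V′Φ³ > 0` with
  `V = −(log Φ)″`;
* regime N: `Ne^{−2u} = u(F₁² − F₀F₂) + F₀F₁ > 0` (`checkN`, `formN_pos_of_checkN`), i.e. `(L/u)′u²Φ² > 0`, the cell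
  carrying a certified `u_lo ≤ u` (`π·e^{4u_lo} ≤ a` via `expPosHi` and `Real.pi_lt_d20`).

Each check evaluates the form in exact-ℚ interval arithmetic on the cell enclosures of toolbox 3 (`decide` in the
kernel, next file) and the soundness theorems turn a `true` into the real inequality on the whole cell; `*_of_all`
combine a covering list of checked cells. WHAT THIS IS NOT: nothing here bears on the zeros of `ζ`.
References: Csordas–Varga 1988, Thm 2.2 [CsordasVarga1988]; Varga 1990 §3.3 [Varga1990].
-/

-- D-0017: `Summit.RiemannHypothesis.RiemannHypothesis.…` duplicates the namespace BY DESIGN (single-problem summit).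
set_option linter.dupNamespace false

namespace Summit.RiemannHypothesis.RiemannHypothesis.Theorems.JensenPolynomials.CoeffTable

open Finset Literature.NumberTheory.LFunctions
open scoped BigOperators Nat Real

/-! ## 8. The five polynomials `P₀, …, P₄` of `Φ, Φ′, Φ″, Φ‴, Φ⁗`, their series, and the three forms -/

/-- Coefficient lists of `P₀(y) = 2y² − 3y`, `P₁ = −8y³ + 30y² − 15y`, `P₂ = 32y⁴ − 224y³ + 330y² − 75y`,
`P₃ = −128y⁵ + 1440y⁴ − 4232y³ + 3270y² − 375y`, `P₄ = 512y⁶ − 8448y⁵ + 41408y⁴ − 68096y³ + 30930y² − 1875y`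
(`Φ^{(m)}(u) = eᵘ ∑_n P_m(y_n)e^{−y_n}`; index `≥ 4` returns `P₄`). -/
def Qc : ℕ → List ℚ
  | 0 => [0, -3, 2]
  | 1 => [0, -15, 30, -8]
  | 2 => [0, -75, 330, -224, 32]
  | 3 => [0, -375, 3270, -4232, 1440, -128]
  | _ => [0, -1875, 30930, -68096, 41408, -8448, 512]

/-- All five lists have length `≤ 7`. -/
theorem Qc_length (m : ℕ) : (Qc m).length ≤ 7 := by
  rcases m with _ | _ | _ | _ | _ <;> simp [Qc]

/-- The series `F_m(x) = ∑_n P_m(y_n)e^{−y_n}` (so that `Φ^{(m)}(u) = eᵘ F_m(e^{4u})`). -/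
noncomputable def phiSeries (m : ℕ) (x : ℝ) : ℝ := ∑' n, qterm (Qc m) x n

/-- Interval of the form `−S₀²S₄ + S₀S₁S₃ + 3S₀S₂² − 3S₁²S₂` (sign of `T′ = (V′Φ³)′`) on the cell `[a, a+h]`. -/
def formAIv (a h : ℚ) : Iv :=
  let I0 := cellIv (Qc 0) a h
  let I1 := cellIv (Qc 1) a h
  let I2 := cellIv (Qc 2) a h
  let I3 := cellIv (Qc 3) a h
  let I4 := cellIv (Qc 4) a h
  ivAdd (ivAdd (ivNeg (ivMul (ivMul I0 I0) I4)) (ivMul (ivMul I0 I1) I3))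
    (ivAdd (ivScale 3 (ivMul I0 (ivMul I2 I2))) (ivScale (-3) (ivMul (ivMul I1 I1) I2)))

/-- Interval of the form `−S₀²S₃ + 3S₀S₁S₂ − 2S₁³` (sign of `T = V′Φ³`) on the cell `[a, a+h]`. -/
def formTIv (a h : ℚ) : Iv :=
  let I0 := cellIv (Qc 0) a h
  let I1 := cellIv (Qc 1) a h
  let I2 := cellIv (Qc 2) a h
  let I3 := cellIv (Qc 3) a h
  ivAdd (ivAdd (ivNeg (ivMul (ivMul I0 I0) I3)) (ivScale 3 (ivMul (ivMul I0 I1) I2)))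
    (ivScale (-2) (ivMul (ivMul I1 I1) I1))

/-- Cell check, regime A (`T′ > 0`): `a ≥ 3` and the form interval has positive lower end. -/
def checkA (c : ℚ × ℚ) : Bool := decide (3 ≤ c.1) && decide (0 < (formAIv c.1 c.2).1)

/-- Cell check, regime T (`T > 0`). -/
def checkT (c : ℚ × ℚ) : Bool := decide (3 ≤ c.1) && decide (0 < (formTIv c.1 c.2).1)

/-- A rational upper bound of `π` (`Real.pi_lt_d20`). -/
def piHi : ℚ := 3.14159265358979323847

/-- Cell check, regime N (`N = u(Φ′² − ΦΦ″) + ΦΦ′ > 0` with `u ≥ u_lo`): the cell carries `u_lo` with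
`π·e^{4u_lo} ≤ a` (certified by `expPosHi`), `S₁² − S₀S₂` has positive lower end `p`, and `u_lo·p + (S₀S₁).lo > 0`. -/
def checkN (c : ℚ × ℚ × ℚ) : Bool :=
  let a := c.1
  let h := c.2.1
  let ul := c.2.2
  let I0 := cellIv (Qc 0) a h
  let I1 := cellIv (Qc 1) a h
  let I2 := cellIv (Qc 2) a h
  let P := ivAdd (ivMul I1 I1) (ivNeg (ivMul I0 I2))
  decide (3 ≤ a) && decide (0 ≤ ul) && decide (4 * ul ≤ 1) && decide (piHi * expPosHi (4 * ul) ≤ a) &&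
    decide (0 < P.1) && decide (0 < ul * P.1 + (ivMul I0 I1).1)

/-- `e^{y_0}·F_m(x)` lies in the cell interval of `P_m`. -/
theorem mem_cellIv_phiSeries (m : ℕ) {a h : ℚ} (ha : 3 ≤ a) {x : ℝ} (hx : 0 < x)
    (h1 : (a : ℝ) ≤ thetaFreq x 0) (h2 : thetaFreq x 0 ≤ (a : ℝ) + h) :
    Mem (Real.exp (thetaFreq x 0) * phiSeries m x) (cellIv (Qc m) a h) :=
  mem_cellIv (Qc m) (Qc_length m) ha hx h1 h2

/-- **Regime A soundness**: `checkA (a, h)` certifies `−F₀²F₄ + F₀F₁F₃ + 3F₀F₂² − 3F₁²F₂ > 0` at every `x > 0`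
with `y_0 = πx ∈ [a, a + h]`. -/
theorem formA_pos_of_checkA {a h : ℚ} (hc : checkA (a, h) = true) {x : ℝ} (hx : 0 < x)
    (h1 : (a : ℝ) ≤ thetaFreq x 0) (h2 : thetaFreq x 0 ≤ (a : ℝ) + h) :
    0 < -(phiSeries 0 x ^ 2 * phiSeries 4 x) + phiSeries 0 x * phiSeries 1 x * phiSeries 3 x +
      3 * phiSeries 0 x * phiSeries 2 x ^ 2 - 3 * phiSeries 1 x ^ 2 * phiSeries 2 x := by
  simp only [checkA, Bool.and_eq_true, decide_eq_true_eq] at hc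
  obtain ⟨ha, hpos⟩ := hc
  have hm := fun m => mem_cellIv_phiSeries m ha hx h1 h2
  set E := Real.exp (thetaFreq x 0) with hE
  have hE0 : 0 < E := Real.exp_pos _
  have key : Mem (-(E * phiSeries 0 x * (E * phiSeries 0 x) * (E * phiSeries 4 x)) +
      E * phiSeries 0 x * (E * phiSeries 1 x) * (E * phiSeries 3 x) +
      (((3 : ℚ) : ℝ) * (E * phiSeries 0 x * (E * phiSeries 2 x * (E * phiSeries 2 x))) +
       ((-3 : ℚ) : ℝ) * (E * phiSeries 1 x * (E * phiSeries 1 x) * (E * phiSeries 2 x)))) (formAIv a h) := by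
    unfold formAIv
    exact mem_ivAdd (mem_ivAdd (mem_ivNeg (mem_ivMul (mem_ivMul (hm 0) (hm 0)) (hm 4)))
      (mem_ivMul (mem_ivMul (hm 0) (hm 1)) (hm 3)))
      (mem_ivAdd (mem_ivScale 3 (mem_ivMul (hm 0) (mem_ivMul (hm 2) (hm 2))))
        (mem_ivScale (-3) (mem_ivMul (mem_ivMul (hm 1) (hm 1)) (hm 2))))
  have hposR := pos_of_mem key hpos
  have e : -(E * phiSeries 0 x * (E * phiSeries 0 x) * (E * phiSeries 4 x)) +
      E * phiSeries 0 x * (E * phiSeries 1 x) * (E * phiSeries 3 x) +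
      (((3 : ℚ) : ℝ) * (E * phiSeries 0 x * (E * phiSeries 2 x * (E * phiSeries 2 x))) +
       ((-3 : ℚ) : ℝ) * (E * phiSeries 1 x * (E * phiSeries 1 x) * (E * phiSeries 2 x))) =
      E ^ 3 * (-(phiSeries 0 x ^ 2 * phiSeries 4 x) + phiSeries 0 x * phiSeries 1 x * phiSeries 3 x +
      3 * phiSeries 0 x * phiSeries 2 x ^ 2 - 3 * phiSeries 1 x ^ 2 * phiSeries 2 x) := by
    push_cast; ring
  rw [e] at hposR
  rcases (mul_pos_iff.mp hposR) with ⟨_, h2⟩ | ⟨h1, _⟩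
  · exact h2
  · exact absurd h1 (not_lt.mpr (pow_pos hE0 3).le)

/-- **Regime T soundness**: `checkT (a, h)` certifies `−F₀²F₃ + 3F₀F₁F₂ − 2F₁³ > 0`. -/
theorem formT_pos_of_checkT {a h : ℚ} (hc : checkT (a, h) = true) {x : ℝ} (hx : 0 < x)
    (h1 : (a : ℝ) ≤ thetaFreq x 0) (h2 : thetaFreq x 0 ≤ (a : ℝ) + h) :
    0 < -(phiSeries 0 x ^ 2 * phiSeries 3 x) + 3 * phiSeries 0 x * phiSeries 1 x * phiSeries 2 x -
      2 * phiSeries 1 x ^ 3 := by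
  simp only [checkT, Bool.and_eq_true, decide_eq_true_eq] at hc
  obtain ⟨ha, hpos⟩ := hc
  have hm := fun m => mem_cellIv_phiSeries m ha hx h1 h2
  set E := Real.exp (thetaFreq x 0) with hE
  have hE0 : 0 < E := Real.exp_pos _
  have key : Mem (-(E * phiSeries 0 x * (E * phiSeries 0 x) * (E * phiSeries 3 x)) +
      ((3 : ℚ) : ℝ) * (E * phiSeries 0 x * (E * phiSeries 1 x) * (E * phiSeries 2 x)) +
      ((-2 : ℚ) : ℝ) * (E * phiSeries 1 x * (E * phiSeries 1 x) * (E * phiSeries 1 x))) (formTIv a h) := by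
    unfold formTIv
    exact mem_ivAdd (mem_ivAdd (mem_ivNeg (mem_ivMul (mem_ivMul (hm 0) (hm 0)) (hm 3)))
      (mem_ivScale 3 (mem_ivMul (mem_ivMul (hm 0) (hm 1)) (hm 2))))
      (mem_ivScale (-2) (mem_ivMul (mem_ivMul (hm 1) (hm 1)) (hm 1)))
  have hposR := pos_of_mem key hpos
  have e : -(E * phiSeries 0 x * (E * phiSeries 0 x) * (E * phiSeries 3 x)) +
      ((3 : ℚ) : ℝ) * (E * phiSeries 0 x * (E * phiSeries 1 x) * (E * phiSeries 2 x)) +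
      ((-2 : ℚ) : ℝ) * (E * phiSeries 1 x * (E * phiSeries 1 x) * (E * phiSeries 1 x)) =
      E ^ 3 * (-(phiSeries 0 x ^ 2 * phiSeries 3 x) + 3 * phiSeries 0 x * phiSeries 1 x * phiSeries 2 x -
      2 * phiSeries 1 x ^ 3) := by
    push_cast; ring
  rw [e] at hposR
  rcases (mul_pos_iff.mp hposR) with ⟨_, h2⟩ | ⟨h1, _⟩
  · exact h2
  · exact absurd h1 (not_lt.mpr (pow_pos hE0 3).le)

/-- **Regime N soundness**: `checkN (a, h, u_lo)` certifies `u(F₁² − F₀F₂) + F₀F₁ > 0` at `x = e^{4u}` with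
`y_0 = πe^{4u} ∈ [a, a + h]` (the rational `u_lo ≤ u` is certified inside the check). -/
theorem formN_pos_of_checkN {a h ul : ℚ} (hc : checkN (a, h, ul) = true) {u : ℝ}
    (h1 : (a : ℝ) ≤ thetaFreq (Real.exp (4 * u)) 0) (h2 : thetaFreq (Real.exp (4 * u)) 0 ≤ (a : ℝ) + h) :
    0 < u * (phiSeries 1 (Real.exp (4 * u)) ^ 2 - phiSeries 0 (Real.exp (4 * u)) * phiSeries 2 (Real.exp (4 * u))) +
      phiSeries 0 (Real.exp (4 * u)) * phiSeries 1 (Real.exp (4 * u)) := by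
  simp only [checkN, Bool.and_eq_true, decide_eq_true_eq] at hc
  obtain ⟨⟨⟨⟨⟨ha, hul0⟩, hul1⟩, hpi⟩, hP⟩, hpos⟩ := hc
  set x := Real.exp (4 * u) with hxdef
  have hx : 0 < x := Real.exp_pos _
  have hm := fun m => mem_cellIv_phiSeries m ha hx h1 h2
  set E := Real.exp (thetaFreq x 0) with hE
  have hE0 : 0 < E := Real.exp_pos _
  -- `u_lo ≤ u`
  have hulo : (ul : ℝ) ≤ u := by
    by_contra hlt
    rw [not_le] at hlt
    have hexp : Real.exp (4 * u) < (expPosHi (4 * ul) : ℝ) := by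
      calc Real.exp (4 * u) < Real.exp (((4 * ul : ℚ) : ℝ)) := Real.exp_lt_exp.2 (by push_cast; linarith)
        _ ≤ _ := exp_le_expPosHi (by linarith) hul1
    have hy : thetaFreq x 0 = Real.pi * Real.exp (4 * u) := by simp [thetaFreq, hxdef]
    have hpi' : Real.pi ≤ (piHi : ℝ) := by
      have := Real.pi_lt_d20; unfold piHi; push_cast; linarith
    have hpos' : (0 : ℝ) < (expPosHi (4 * ul) : ℝ) := lt_trans (Real.exp_pos _) hexp
    have : thetaFreq x 0 < (a : ℝ) := by
      calc thetaFreq x 0 = Real.pi * Real.exp (4 * u) := hy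
        _ < Real.pi * (expPosHi (4 * ul) : ℝ) := mul_lt_mul_of_pos_left hexp Real.pi_pos
        _ ≤ (piHi : ℝ) * (expPosHi (4 * ul) : ℝ) := mul_le_mul_of_nonneg_right hpi' hpos'.le
        _ ≤ (a : ℝ) := by exact_mod_cast hpi
    linarith
  -- the two pieces
  have keyP : Mem (E * phiSeries 1 x * (E * phiSeries 1 x) + -(E * phiSeries 0 x * (E * phiSeries 2 x)))
      (ivAdd (ivMul (cellIv (Qc 1) a h) (cellIv (Qc 1) a h))
        (ivNeg (ivMul (cellIv (Qc 0) a h) (cellIv (Qc 2) a h)))) :=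
    mem_ivAdd (mem_ivMul (hm 1) (hm 1)) (mem_ivNeg (mem_ivMul (hm 0) (hm 2)))
  have keyB : Mem (E * phiSeries 0 x * (E * phiSeries 1 x)) (ivMul (cellIv (Qc 0) a h) (cellIv (Qc 1) a h)) :=
    mem_ivMul (hm 0) (hm 1)
  have hPR : ((ivAdd (ivMul (cellIv (Qc 1) a h) (cellIv (Qc 1) a h))
      (ivNeg (ivMul (cellIv (Qc 0) a h) (cellIv (Qc 2) a h)))).1 : ℝ) ≤
      E * phiSeries 1 x * (E * phiSeries 1 x) + -(E * phiSeries 0 x * (E * phiSeries 2 x)) := keyP.1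
  have hBR := keyB.1
  have hP' : (0 : ℝ) < ((ivAdd (ivMul (cellIv (Qc 1) a h) (cellIv (Qc 1) a h))
      (ivNeg (ivMul (cellIv (Qc 0) a h) (cellIv (Qc 2) a h)))).1 : ℝ) := by exact_mod_cast hP
  have hpos' : (0 : ℝ) < (ul : ℝ) * ((ivAdd (ivMul (cellIv (Qc 1) a h) (cellIv (Qc 1) a h))
      (ivNeg (ivMul (cellIv (Qc 0) a h) (cellIv (Qc 2) a h)))).1 : ℝ) +
      ((ivMul (cellIv (Qc 0) a h) (cellIv (Qc 1) a h)).1 : ℝ) := by exact_mod_cast hpos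
  have hul0' : (0 : ℝ) ≤ (ul : ℝ) := by exact_mod_cast hul0
  have hmain : 0 < u * (E * phiSeries 1 x * (E * phiSeries 1 x) + -(E * phiSeries 0 x * (E * phiSeries 2 x))) +
      E * phiSeries 0 x * (E * phiSeries 1 x) := by
    have step1 : (ul : ℝ) * ((ivAdd (ivMul (cellIv (Qc 1) a h) (cellIv (Qc 1) a h))
        (ivNeg (ivMul (cellIv (Qc 0) a h) (cellIv (Qc 2) a h)))).1 : ℝ) ≤
        u * (E * phiSeries 1 x * (E * phiSeries 1 x) + -(E * phiSeries 0 x * (E * phiSeries 2 x))) :=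
      mul_le_mul hulo hPR hP'.le (hul0'.trans hulo)
    linarith
  have e : u * (E * phiSeries 1 x * (E * phiSeries 1 x) + -(E * phiSeries 0 x * (E * phiSeries 2 x))) +
      E * phiSeries 0 x * (E * phiSeries 1 x) =
      E ^ 2 * (u * (phiSeries 1 x ^ 2 - phiSeries 0 x * phiSeries 2 x) + phiSeries 0 x * phiSeries 1 x) := by ring
  rw [e] at hmain
  rcases (mul_pos_iff.mp hmain) with ⟨_, h2⟩ | ⟨h1, _⟩
  · exact h2
  · exact absurd h1 (not_lt.mpr (pow_pos hE0 2).le)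

/-! ## 9. Regions: a checked, covering list of cells certifies the form on a whole interval of `y_0` -/

/-- Regime A on a covered interval. -/
theorem formA_pos_of_all {cells : List (ℚ × ℚ)} {lo hi : ℚ} (hall : cells.all checkA = true)
    (hcov : covers cells lo hi = true) {x : ℝ} (hx : 0 < x) (h1 : (lo : ℝ) ≤ thetaFreq x 0)
    (h2 : thetaFreq x 0 ≤ (hi : ℝ)) :
    0 < -(phiSeries 0 x ^ 2 * phiSeries 4 x) + phiSeries 0 x * phiSeries 1 x * phiSeries 3 x +
      3 * phiSeries 0 x * phiSeries 2 x ^ 2 - 3 * phiSeries 1 x ^ 2 * phiSeries 2 x := by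
  obtain ⟨c, hc, hc1, hc2⟩ := mem_cell_of_covers hcov h1 h2
  have hck : checkA (c.1, c.2) = true := by simpa using List.all_eq_true.mp hall c hc
  exact formA_pos_of_checkA hck hx hc1 hc2

/-- Regime T on a covered interval. -/
theorem formT_pos_of_all {cells : List (ℚ × ℚ)} {lo hi : ℚ} (hall : cells.all checkT = true)
    (hcov : covers cells lo hi = true) {x : ℝ} (hx : 0 < x) (h1 : (lo : ℝ) ≤ thetaFreq x 0)
    (h2 : thetaFreq x 0 ≤ (hi : ℝ)) :
    0 < -(phiSeries 0 x ^ 2 * phiSeries 3 x) + 3 * phiSeries 0 x * phiSeries 1 x * phiSeries 2 x -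
      2 * phiSeries 1 x ^ 3 := by
  obtain ⟨c, hc, hc1, hc2⟩ := mem_cell_of_covers hcov h1 h2
  have hck : checkT (c.1, c.2) = true := by simpa using List.all_eq_true.mp hall c hc
  exact formT_pos_of_checkT hck hx hc1 hc2

/-- Regime N on a covered interval (cells carry their `u_lo`). -/
theorem formN_pos_of_all {cells : List (ℚ × ℚ × ℚ)} {lo hi : ℚ} (hall : cells.all checkN = true)
    (hcov : covers (cells.map fun c => (c.1, c.2.1)) lo hi = true) {u : ℝ}
    (h1 : (lo : ℝ) ≤ thetaFreq (Real.exp (4 * u)) 0) (h2 : thetaFreq (Real.exp (4 * u)) 0 ≤ (hi : ℝ)) :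
    0 < u * (phiSeries 1 (Real.exp (4 * u)) ^ 2 - phiSeries 0 (Real.exp (4 * u)) * phiSeries 2 (Real.exp (4 * u))) +
      phiSeries 0 (Real.exp (4 * u)) * phiSeries 1 (Real.exp (4 * u)) := by
  obtain ⟨c, hc, hc1, hc2⟩ := mem_cell_of_covers hcov h1 h2
  obtain ⟨c', hc', rfl⟩ := List.mem_map.mp hc
  have hck : checkN (c'.1, c'.2.1, c'.2.2) = true := by simpa using List.all_eq_true.mp hall c' hc'
  exact formN_pos_of_checkN hck hc1 hc2

end Summit.RiemannHypothesis.RiemannHypothesis.Theorems.JensenPolynomials.CoeffTable
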